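import Mathlib
import Literature.MathematicalPhysics.QuantumLattice.HubbardTorusTwoPointSmallCoupling
import Summits.HubbardSuperconductivity.HubbardSuperconductivity.Theorems.KLProgrammeH10RungCompactBoxFreeDecay
import HarnessLib

/-!
# Route KLProgramme — support item R0′ `H10RungCompactBox`, helper 3/4: the single-scale corner of the
two-point thermodynamic limit UNIFORM on compact boxes of `(β, μ)`

`HubbardTorusTwoPointSmallCoupling` proves, for EACH `(β, μ)`, a radius `r(β, μ) = (96 e β C S + 1)⁻¹` with
`‖t_j(L)‖ ≤ 2e / rʲ` for the truncated coefficients of the torus two-point function (`C` the free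
propagator's decay constant on the time window `[-2β, β]`), whence the limit for `|U| < r(β, μ)`. With the
box-uniform decay constant of helper 2 (`h10rung_norm_free_twoPoint_le_box` on `[-2B, B] × [0, B] × [μa, μb]`)
the same computation gives ONE radius `r(B, μa, μb) = (96 e B C S + 1)⁻¹` for the whole box
(`h10rung_truncatedCoeff_le_geometric_box`), and `tendsto_hubbardThermalTwoPoint_of_truncated_bounds` +
`termwise_limit_hubbardTorusTruncatedCoeff` give the two-point limit for all `β ∈ (0, B]`, `μ ∈ [μa, μb]`,
`|U| < r` (`h10rung_twoPoint_limit_box`) — the compact-box corner of REF-CHECK §13 FINDING-1 option (α).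
-/

noncomputable section

-- the tree's namespace `Summit.<Summit>.<Problem>.Theorems` repeats the summit name by design (D-0017)
set_option linter.dupNamespace false

open MeasureTheory Set Filter Topology
open Literature.Probability.LatticeModels
open Literature.MathematicalPhysics.QuantumLattice

namespace Summit.HubbardSuperconductivity.HubbardSuperconductivity.Theorems

/-- **The volume-uniform geometric bound on the truncated coefficients, uniform on the parameter box**:
for all `B, μa, μb` there are `r > 0` and `A ≥ 0` with `‖t_j(L)‖ ≤ A / rʲ` for all `β ∈ [0, B]`,
`μ ∈ [μa, μb]`, `L ≥ 3`, sites, spins and orders (the tree's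
`exists_norm_hubbardTorusTruncatedCoeff_le_geometric` with `r = (96 e B C S + 1)⁻¹`, `C` the box decay
constant; Benfatto–Giuliani–Mastropietro 2006 (2.77)). -/
theorem h10rung_truncatedCoeff_le_geometric_box (B μa μb : ℝ) :
    ∃ r : ℝ, 0 < r ∧ ∃ A : ℝ, 0 ≤ A ∧ ∀ β ∈ Icc 0 B, ∀ μ ∈ Icc μa μb, ∀ (L : ℕ), 3 ≤ L →
      ∀ (x y : Site 2) (σ σ' : Fin 2) (j : ℕ), ‖hubbardTorusTruncatedCoeff β μ L x y σ σ' j‖ ≤ A / r ^ j := by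
  -- box decay data for the separations `[-2B, B]`, `K = 4`
  obtain ⟨C, hCpos, hC⟩ := h10rung_norm_free_twoPoint_le_box (-(2 * B)) B B μa μb (K := 4) le_rfl
  set S : ℝ := ∑' z : Site 2, ((1 + ‖z‖) ^ 4)⁻¹ with hS
  have hS0 : 0 ≤ S := tsum_nonneg fun z => by positivity
  have hCS : 0 ≤ C * S := by positivity
  set ϱ : ℝ := 96 * Real.exp 1 * B * (C * S) + 1 with hϱ
  -- `B ≥ 0` as soon as the box is non-empty; handle the empty box through `max B 0`
  set ϱ' : ℝ := 96 * Real.exp 1 * max B 0 * (C * S) + 1 with hϱ'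
  have hϱ'1 : 1 ≤ ϱ' := by
    have : 0 ≤ 96 * Real.exp 1 * max B 0 * (C * S) := by positivity
    linarith
  have hϱ'pos : 0 < ϱ' := by linarith
  refine ⟨ϱ'⁻¹, by positivity, 2 * Real.exp 1, by positivity, fun β hβ μ hμ L hL x y σ σ' j => ?_⟩
  -- the decay hypothesis on the window `[-2β, β] ⊆ [-2B, B]`
  have hC' : ∀ (L : ℕ), 3 ≤ L → ∀ (t s : ℝ), s - t ∈ Icc (-(2 * β)) β →
      ∀ (x₁ y₁ : Site 2) (σ₁ σ₂ : Fin 2),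
        ‖hubbardThermalTwoPointEvolved β 0 μ L x₁ σ₁ (t : ℂ) y₁ σ₂ (s : ℂ)‖ ≤
          C * ((1 + (tnZ L (y₁ - x₁) : ℝ)) ^ 4)⁻¹ := by
    intro L' hL' t s hts x₁ y₁ σ₁ σ₂
    exact hC β hβ μ hμ L' hL' t s ⟨by linarith [hts.1, hβ.2], by linarith [hts.2, hβ.2]⟩ x₁ y₁ σ₁ σ₂
  refine (norm_hubbardTorusTruncatedCoeff_le β μ hβ.1 le_rfl hCpos.le hC' hL x y σ σ' j).trans ?_
  rw [inv_pow, div_inv_eq_mul]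
  -- `(j+1)^{j-1}/j! ≤ e^{j+1}`
  have hfact : ((j + 1 : ℕ) : ℝ) ^ (j - 1) / j.factorial ≤ Real.exp 1 ^ (j + 1) := by
    have hj1 : (1 : ℝ) ≤ ((j + 1 : ℕ) : ℝ) := by exact_mod_cast Nat.succ_le_succ (Nat.zero_le j)
    calc ((j + 1 : ℕ) : ℝ) ^ (j - 1) / j.factorial ≤ ((j + 1 : ℕ) : ℝ) ^ j / j.factorial :=
          div_le_div_of_nonneg_right (pow_le_pow_right₀ hj1 (Nat.sub_le j 1)) (by positivity)
      _ = ((j + 1 : ℕ) : ℝ) ^ (j + 1) / (j + 1).factorial := by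
          rw [Nat.factorial_succ, pow_succ]
          push_cast
          field_simp
      _ ≤ Real.exp ((j + 1 : ℕ) : ℝ) :=
          Real.pow_div_factorial_le_exp (x := ((j + 1 : ℕ) : ℝ)) (by positivity) (j + 1)
      _ = Real.exp 1 ^ (j + 1) := by rw [← Real.exp_nat_mul, mul_one]
  have h4 : (2 : ℝ) ^ (j * 2 + 1) = 2 * 4 ^ j := by
    rw [pow_succ, mul_comm j 2, pow_mul]; norm_num; ring
  have hβB : β ≤ max B 0 := hβ.2.trans (le_max_left _ _)
  calc β ^ j / j.factorial * (((j + 1 : ℕ) : ℝ) ^ (j - 1) *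
        ((2 : ℝ) ^ (j * 2 + 1) * (8 * (3 * (C * S))) ^ j))
      = (((j + 1 : ℕ) : ℝ) ^ (j - 1) / j.factorial) * (β ^ j * (2 * 4 ^ j * (24 * (C * S)) ^ j)) := by
        rw [h4]; ring
    _ ≤ Real.exp 1 ^ (j + 1) * (β ^ j * (2 * 4 ^ j * (24 * (C * S)) ^ j)) := by
        have : 0 ≤ β ^ j * (2 * 4 ^ j * (24 * (C * S)) ^ j) := by
          have := hβ.1; positivity
        gcongr
    _ = 2 * Real.exp 1 * (96 * Real.exp 1 * β * (C * S)) ^ j := by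
        have h96 : (96 : ℝ) ^ j = 4 ^ j * 24 ^ j := by rw [← mul_pow]; norm_num
        simp only [mul_pow, pow_succ]
        rw [h96]
        ring
    _ ≤ 2 * Real.exp 1 * ϱ' ^ j := by
        have hb0 : 0 ≤ 96 * Real.exp 1 * β * (C * S) := by have := hβ.1; positivity
        gcongr
        rw [hϱ']
        have : 96 * Real.exp 1 * β * (C * S) ≤ 96 * Real.exp 1 * max B 0 * (C * S) := by gcongr
        linarith

/-- **The two-point thermodynamic limit of the 2D Hubbard model on compact parameter boxes at small
coupling**: for all `B, μa, μb` there is `r > 0` such that for every `β ∈ (0, B]`, `μ ∈ [μa, μb]`, real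
`|U| < r`, all sites and spins, the finite-volume thermal two-point functions
`⟨c†_{xσ} c_{yσ'}⟩_{β,L,U,μ}` converge as `L → ∞` — the single-scale corner of
`HubbardTorusTwoPointSmallCoupling` with the radius uniform on the box (REF-CHECK §13 FINDING-1 (α)). -/
theorem h10rung_twoPoint_limit_box (B μa μb : ℝ) :
    ∃ r : ℝ, 0 < r ∧ ∀ β ∈ Ioc 0 B, ∀ μ ∈ Icc μa μb, ∀ U : ℝ, |U| < r →
      ∀ (x y : Site 2) (σ σ' : Fin 2), ∃ S : ℂ,
        Tendsto (fun L : ℕ => hubbardThermalTwoPoint β U μ L x y σ σ') atTop (𝓝 S) := by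
  obtain ⟨r, hr, A, -, hA⟩ := h10rung_truncatedCoeff_le_geometric_box B μa μb
  refine ⟨r, hr, fun β hβ μ hμ U hU x y σ σ' => ?_⟩
  have hC : ∀ᶠ L : ℕ in atTop, ∀ j : ℕ, ‖hubbardTorusTruncatedCoeff β μ L x y σ σ' j‖ ≤ A / r ^ j := by
    filter_upwards [eventually_ge_atTop 3] with L hL j
    exact hA β ⟨hβ.1.le, hβ.2⟩ μ hμ L hL x y σ σ' j
  exact ⟨_, tendsto_hubbardThermalTwoPoint_of_truncated_bounds β U μ x y σ σ' hU hC
    (termwise_limit_hubbardTorusTruncatedCoeff β μ hβ.1.le x y σ σ')⟩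

end Summit.HubbardSuperconductivity.HubbardSuperconductivity.Theorems

end
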